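import Literature.AlgebraicGeometry.Motives.WeilDiscriminantRealization
import Mathlib.Algebra.Module.MinimalAxioms
import Mathlib.LinearAlgebra.Dimension.Free
import Mathlib.RingTheory.Finiteness.Basic
import HarnessLib

/-!
# The `K`-vector space of a Weil operator (`K = ℚ + ℚ α`, `α² = -d`, `α ↦ J`, `J² = -d`)

Layer `Literature/AlgebraicGeometry/Motives`, companion of `Motives/WeilDiscriminant`,
`Motives/WeilDiscriminantRealization` (`reCoord`, `imCoord` on `K = ℚ + ℚ α`) and of the aiming
arithmetic of the product trick (`Motives/WeilFormAimingArithmetic`). That arithmetic (van Geemen,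
LNM 1594, Lemma 5.2 (2)–(4), 5.4; Markman, arXiv:2509.23403 §11.5 Step 2) is stated for an ABSTRACT
quadratic `ℚ`-algebra `K = ℚ + ℚ α`, `α² = -d`, and a `K`-vector space `V` with a `ℚ`-bilinear form
of Weil type; the rational degree-one model of a Weil pair (`Motives/RationalDegreeOneModel`,
`Motives/RationalDegreeOneModelWeilType`) is a COORDINATE space `ι → ℚ` with the rational matrix
`M` of `φ^*`, `M² = -d`. This file bridges the two, def-free (the `K`-module structure is asserted to
EXIST and its API is stated for any structure in which `α` acts as the given operator):

* `reCoord_mul`, `imCoord_mul` — real and imaginary parts of products in `K`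
  (`(a + bα)(a' + b'α) = (aa' - d bb') + (ab' + ba')α`);
* `exists_module_smul_eq` — **on a `ℚ`-vector space `V` with an operator `J`, `J² = -d`, there is a
  `K`-vector space structure, compatible with the `ℚ`-structure, in which `α` acts as `J`**
  (`k • v = re k • v + im k • J v`);
* for ANY such structure (`[Module K V] [IsScalarTower ℚ K V]`, `α • v = J v`): `smul_eq_reCoord_add_imCoord`,
  `Module.Finite` transfer (`finite_of_weilOperator`), **`2 · dim_K V = dim_ℚ V`**
  (`two_mul_finrank_eq_of_weilOperator`, `dim_ℚ K = 2` by the basis `(1, α)`), and **`J`-stable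
  `ℚ`-subspaces are `K`-subspaces** (`exists_restrictScalars_eq_of_stable`, with `2 · dim_K = dim_ℚ`
  for them).

Pure linear algebra (van Geemen, LNM 1594, 5.2: "`V` is a `K`-vector space through
`K ↪ End(X)_ℚ`", read in coordinates); no named fact. Provenance: first landed on the summit side
(route `HeckePrymWeil` of the Hodge summit, file `Theorems/HeckePrymWeilAimedDescendingOperatorModule`,
same statements and proofs); re-hosted here because the facts that need it are Literature facts,
whose discharges cannot import `Summits` (CONVENTIONS §2).

## References

* [vanGeemen1994HodgeAV] B. van Geemen, An introduction to the Hodge conjecture for abelian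
  varieties, LNM 1594 (1994), Lemma 5.2 (2), 5.4.
-/

noncomputable section

open Module

namespace Literature.AlgebraicGeometry.Motives

section Coordinates

variable {K : Type*} [Field K] [Algebra ℚ K] {α : K} {d : ℚ} (hd : 0 < d)
  (hα : α * α = algebraMap ℚ K (-d))
  (hK : ∀ k : K, ∃ a b : ℚ, k = algebraMap ℚ K a + algebraMap ℚ K b * α)

include hK in
/-- `re (q k) = q re k` for `q ∈ ℚ` (written with `algebraMap`). [folklore] -/
theorem reCoord_algebraMap_mul (q : ℚ) (k : K) :
    reCoord hd hα hK (algebraMap ℚ K q * k) = q * reCoord hd hα hK k := by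
  rw [← Algebra.smul_def, map_smul, smul_eq_mul]

include hK in
/-- `im (q k) = q im k` for `q ∈ ℚ`. [folklore] -/
theorem imCoord_algebraMap_mul (q : ℚ) (k : K) :
    imCoord hd hα hK (algebraMap ℚ K q * k) = q * imCoord hd hα hK k := by
  rw [← Algebra.smul_def, map_smul, smul_eq_mul]

/-- **`re (k k') = re k · re k' - d · im k · im k'`.** [folklore] -/
theorem reCoord_mul (k k' : K) :
    reCoord hd hα hK (k * k') =
      reCoord hd hα hK k * reCoord hd hα hK k' - d * (imCoord hd hα hK k * imCoord hd hα hK k') := by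
  conv_lhs => rw [eq_reCoord_add_imCoord hd hα hK k]
  rw [add_mul, map_add, reCoord_algebraMap_mul, mul_assoc, reCoord_algebraMap_mul, reCoord_alpha_mul]
  ring

/-- **`im (k k') = re k · im k' + im k · re k'`.** [folklore] -/
theorem imCoord_mul (k k' : K) :
    imCoord hd hα hK (k * k') =
      reCoord hd hα hK k * imCoord hd hα hK k' + imCoord hd hα hK k * reCoord hd hα hK k' := by
  conv_lhs => rw [eq_reCoord_add_imCoord hd hα hK k]
  rw [add_mul, map_add, imCoord_algebraMap_mul, mul_assoc, imCoord_algebraMap_mul, imCoord_alpha_mul]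

end Coordinates

section Operator

variable {K : Type*} [Field K] [Algebra ℚ K] {α : K} {d : ℚ} (hd : 0 < d)
  (hα : α * α = algebraMap ℚ K (-d))
  (hK : ∀ k : K, ∃ a b : ℚ, k = algebraMap ℚ K a + algebraMap ℚ K b * α)
  {V : Type*} [AddCommGroup V] [Module ℚ V] (J : V →ₗ[ℚ] V) (hJ : ∀ v, J (J v) = -(d • v))

include hd hα hK hJ in
/-- **The `K`-vector space of a Weil operator.** On a `ℚ`-vector space `V` with a `ℚ`-linear
operator `J`, `J² = -d`, there is a `K`-module structure (`K = ℚ + ℚ α`, `α² = -d`) compatible with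
the `ℚ`-structure (`IsScalarTower ℚ K V`) in which `α` acts as `J`: `k • v = re k • v + im k • J v`
(van Geemen, LNM 1594, 5.2: `H¹(X, ℚ)` is a `K`-vector space through `K ↪ End(X)_ℚ`). Stated as an
existence so that no definition is introduced. [cite: vanGeemen1994HodgeAV, Lemma 5.2] -/
theorem exists_module_smul_eq :
    ∃ m : Module K V, (letI := m; IsScalarTower ℚ K V ∧ ∀ v : V, α • v = J v) := by
  letI sm : SMul K V := ⟨fun k v => reCoord hd hα hK k • v + imCoord hd hα hK k • J v⟩
  have hsm : ∀ (k : K) (v : V), k • v = reCoord hd hα hK k • v + imCoord hd hα hK k • J v :=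
    fun _ _ => rfl
  letI m : Module K V := Module.ofMinimalAxioms
    (fun k v w => by simp only [hsm, map_add, smul_add]; abel)
    (fun k k' v => by simp only [hsm, map_add, add_smul]; abel)
    (fun k k' v => by
      simp only [hsm, reCoord_mul hd hα hK, imCoord_mul hd hα hK, map_add, map_smul, hJ, smul_add,
        smul_neg, smul_smul, sub_smul, add_smul]
      ring_nf
      abel)
    (fun v => by simp only [hsm, reCoord_one, imCoord_one, one_smul, zero_smul, add_zero])
  refine ⟨m, ⟨fun q k v => ?_⟩, fun v => ?_⟩
  · change reCoord hd hα hK (q • k) • v + imCoord hd hα hK (q • k) • J v =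
      q • (reCoord hd hα hK k • v + imCoord hd hα hK k • J v)
    rw [map_smul, map_smul, smul_eq_mul, smul_eq_mul, smul_add, smul_smul, smul_smul]
  · change reCoord hd hα hK α • v + imCoord hd hα hK α • J v = J v
    rw [reCoord_alpha, imCoord_alpha, zero_smul, one_smul, zero_add]

variable [Module K V] [IsScalarTower ℚ K V] (hαJ : ∀ v : V, α • v = J v)

include hd hα hK hαJ in
/-- In any compatible `K`-structure with `α` acting as `J`: `k • v = re k • v + im k • J v`. [folklore] -/
theorem smul_eq_reCoord_add_imCoord (k : K) (v : V) :
    k • v = reCoord hd hα hK k • v + imCoord hd hα hK k • J v := by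
  conv_lhs => rw [eq_reCoord_add_imCoord hd hα hK k]
  rw [add_smul, mul_smul, hαJ, algebraMap_smul, algebraMap_smul]

/-- A `ℚ`-finite `V` is `K`-finite. [folklore] -/
theorem finite_of_weilOperator [Module.Finite ℚ V] : Module.Finite K V :=
  Module.Finite.of_restrictScalars_finite ℚ K V

include hd hα hK in
/-- **`2 · dim_K V = dim_ℚ V`** (`dim_ℚ K = 2`, tower law). [cite: vanGeemen1994HodgeAV, Lemma 5.2] -/
theorem two_mul_finrank_eq_of_weilOperator [Module.Finite ℚ V] :
    2 * Module.finrank K V = Module.finrank ℚ V := by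
  have h2 : Module.finrank ℚ K = 2 := by
    rw [Module.finrank_eq_card_basis (basisOneAlpha hd hα hK), Fintype.card_fin]
  rw [← h2, Module.finrank_mul_finrank]

include hd hα hK hαJ in
/-- **`J`-stable `ℚ`-subspaces are `K`-subspaces**: for a `ℚ`-submodule `P` with `J P ⊆ P` there
is a `K`-submodule `P'` with the same carrier (`P'.restrictScalars ℚ = P`).
[cite: vanGeemen1994HodgeAV, Lemma 5.2] -/
theorem exists_restrictScalars_eq_of_stable (P : Submodule ℚ V) (hP : ∀ v ∈ P, J v ∈ P) :
    ∃ P' : Submodule K V, P'.restrictScalars ℚ = P := by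
  refine ⟨{ carrier := P, add_mem' := P.add_mem, zero_mem' := P.zero_mem, smul_mem' := ?_ }, ?_⟩
  · intro k v hv
    change k • v ∈ P
    rw [smul_eq_reCoord_add_imCoord hd hα hK J hαJ]
    exact P.add_mem (P.smul_mem _ hv) (P.smul_mem _ (hP v hv))
  · ext v
    rfl

include hd hα hK in
/-- For a `K`-submodule `P'`, `2 · dim_K P' = dim_ℚ P'` (`dim_ℚ` of the underlying `ℚ`-subspace
`P'.restrictScalars ℚ`). [cite: vanGeemen1994HodgeAV, Lemma 5.2] -/
theorem two_mul_finrank_submodule_eq [Module.Finite ℚ V] (P' : Submodule K V) :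
    2 * Module.finrank K P' = Module.finrank ℚ (P'.restrictScalars ℚ) := by
  haveI : Module.Finite ℚ P' := Module.Finite.of_injective ((P'.restrictScalars ℚ).subtype) Subtype.val_injective
  have h2 : Module.finrank ℚ K = 2 := by
    rw [Module.finrank_eq_card_basis (basisOneAlpha hd hα hK), Fintype.card_fin]
  rw [← h2, Module.finrank_mul_finrank]
  rfl

/-- `restrictScalars` reflects `⊓ = ⊥`: if `P'.restrictScalars ℚ ⊓ N'.restrictScalars ℚ = ⊥` then
`P' ⊓ N' = ⊥`. [folklore] -/
theorem inf_eq_bot_of_restrictScalars {P' N' : Submodule K V}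
    (h : P'.restrictScalars ℚ ⊓ N'.restrictScalars ℚ = ⊥) : P' ⊓ N' = ⊥ := by
  rw [eq_bot_iff]
  intro v hv
  have hv' : v ∈ P'.restrictScalars ℚ ⊓ N'.restrictScalars ℚ := hv
  rw [h] at hv'
  exact hv'

end Operator

end Literature.AlgebraicGeometry.Motives

end
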